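import Summits.Ventures.HSemireg.ObstructionLocusBlockDevissage
import Summits.Ventures.HSemireg.ObstructionLocusCrossingExtTools

/-!
# Venture HSemireg — (S5) OBSTRUCTION LOCUS away from secant type, XXXII: the CORE of EXT-NOTE §6.B(c) at a crossing
# germ — the Hilbert–Burch matrix as a scalar matrix, and the double cokernel `D(R) = Ext¹_R(I_S, I_S) = N_S`

HONEST FRAMING.  Part of the Lean side of the computation cell `pub-hsemireg` (track «S4-PUSH» (ii), seat
s4-prove-2).  Plain commutative / homological algebra in `R = MvPolynomial (Fin n) K`, every `n`, EVERY commutative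
ring `K`.  Nothing here constructs a variety or a sheaf; nothing here says that HC / HC_CM / HC_AV holds; no Literature
fact is declared or used; no object is certified.

* `hbMatrix S a₀` — the entries `± x_c` of the Hilbert–Burch matrix; `hbMap_eq_scalarMatrix` — file XXVII's `Φ_V` IS
  the scalar matrix `hbMatrix` acting on `V`-valued vectors (so file XXXI's transport lemmas apply to it);
* `hbSES S ha₀` / `hbSES_shortExact` — `0 → R^{S∖a₀} →Φ R^S →E I_S → 0` with honest `R`-valued powers;
* **`coreEquiv`** — `(I_S)^{S∖a₀} ⧸ range(Φᵀ on I_S-valued vectors) ≃ₗ[R] Ext¹_R(I_S, I_S)` (the `k = 0` cokernel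
  of file XXXI along `hbSES`, `R^S` being free);
* **`coreEquivBranch`** — `… ≃ₗ[R] N_S = Π_{(a,b) ∈ Br(S)} R ⧸ (x_b, x_a)` (∘ file XXVI's `extOneEquivOfUnique`).
References (dictionary only): EXT-NOTE.md §6.A, §6.B(b)(c).
-/

open CategoryTheory CategoryTheory.Abelian MvPolynomial Finset
open scoped BigOperators

universe u

namespace Summit.Ventures.HSemireg.ObstructionLocus.BlockModel

variable {K : Type u} [CommRing K] {n : ℕ}

/-! ## The Hilbert–Burch matrix as a scalar matrix -/

section HB

variable (S : Finset (Fin n)) (a₀ : Fin n)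

/-- The entries of `Φ`: column `b ∈ S ∖ a₀` has `x_b` in row `b`, `−x_{a₀}` in row `a₀`, `0` elsewhere. -/
noncomputable def hbMatrix : ↥S → ↥(S.erase a₀) → MvPolynomial (Fin n) K :=
  fun a b => if (a : Fin n) = a₀ then -X a₀ else if (b : Fin n) = a then X (a : Fin n) else 0

variable {M : Type u} [AddCommGroup M] [Module (MvPolynomial (Fin n) K) M]

/-- Row `a₀` of `Φ ⊗ 1_M`. -/
theorem scalarMatrix_hbMatrix_apply_of_eq (w : ↥(S.erase a₀) → M) (a : ↥S) (h : (a : Fin n) = a₀) :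
    scalarMatrix M (hbMatrix (K := K) S a₀) w a = -((X a₀ : MvPolynomial (Fin n) K) • ∑ b, w b) := by
  rw [scalarMatrix_apply, Finset.smul_sum, ← Finset.sum_neg_distrib]
  refine Finset.sum_congr rfl fun b _ => ?_
  simp [hbMatrix, h, neg_smul]

/-- The other rows of `Φ ⊗ 1_M`. -/
theorem scalarMatrix_hbMatrix_apply_of_ne (w : ↥(S.erase a₀) → M) (a : ↥S) (h : (a : Fin n) ≠ a₀) :
    scalarMatrix M (hbMatrix (K := K) S a₀) w a =
      (X (a : Fin n) : MvPolynomial (Fin n) K) • w ⟨a, Finset.mem_erase.2 ⟨h, a.2⟩⟩ := by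
  rw [scalarMatrix_apply, Finset.sum_eq_single ⟨(a : Fin n), Finset.mem_erase.2 ⟨h, a.2⟩⟩]
  · simp [hbMatrix, h]
  · intro b _ hb
    have : (b : Fin n) ≠ a := fun h' => hb (Subtype.ext h')
    simp [hbMatrix, h, this]
  · intro h'; exact absurd (Finset.mem_univ _) h'

/-- **File XXVII's `Φ_V` is the scalar matrix `hbMatrix` on `V`-valued vectors.** -/
theorem hbMap_eq_scalarMatrix (V : Ideal (MvPolynomial (Fin n) K)) :
    hbMap S a₀ V = scalarMatrix ↥V (hbMatrix S a₀) := by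
  apply LinearMap.ext
  intro w
  funext a
  by_cases h : (a : Fin n) = a₀
  · rw [hbMap_apply_of_eq S a₀ V w a h, scalarMatrix_hbMatrix_apply_of_eq S a₀ w a h]
  · rw [hbMap_apply_of_ne S a₀ V w a h, scalarMatrix_hbMatrix_apply_of_ne S a₀ w a h]

/-- The coefficient vector of `Φ(w)` on `R`-valued vectors: `Φ(w)_a = x_a s_a`. -/
noncomputable def hbCoeffR (w : ↥(S.erase a₀) → MvPolynomial (Fin n) K) (a : ↥S) : MvPolynomial (Fin n) K :=
  if h : (a : Fin n) = a₀ then -∑ b, w b else w ⟨a, Finset.mem_erase.2 ⟨h, a.2⟩⟩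

/-- `Φ(w)_a = x_a s_a`. -/
theorem scalarMatrix_hbMatrix_eq_X_mul (w : ↥(S.erase a₀) → MvPolynomial (Fin n) K) (a : ↥S) :
    scalarMatrix (MvPolynomial (Fin n) K) (hbMatrix (K := K) S a₀) w a = X (a : Fin n) * hbCoeffR S a₀ w a := by
  by_cases h : (a : Fin n) = a₀
  · rw [scalarMatrix_hbMatrix_apply_of_eq S a₀ w a h, hbCoeffR, dif_pos h, h, smul_eq_mul, mul_neg]
  · rw [scalarMatrix_hbMatrix_apply_of_ne S a₀ w a h, hbCoeffR, dif_neg h, smul_eq_mul]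

variable {S a₀} in
/-- `Σ_a s_a = 0`. -/
theorem sum_hbCoeffR (ha₀ : a₀ ∈ S) (w : ↥(S.erase a₀) → MvPolynomial (Fin n) K) :
    ∑ a, hbCoeffR S a₀ w a = 0 := by
  rw [sum_coe_eq_add_sum_erase ha₀, hbCoeffR, dif_pos rfl]
  have : ∀ b : ↥(S.erase a₀),
      hbCoeffR S a₀ w ⟨b.1, Finset.mem_of_mem_erase b.2⟩ = w b := by
    intro b
    rw [hbCoeffR, dif_neg (Finset.mem_erase.1 b.2).1]
  simp only [this, neg_add_cancel]

variable {S a₀} in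
/-- `E ∘ Φ = 0` on `R`-valued vectors. -/
theorem blockGenMap_scalarMatrix_hbMatrix (ha₀ : a₀ ∈ S) (w : ↥(S.erase a₀) → MvPolynomial (Fin n) K) :
    blockGenMap S (scalarMatrix (MvPolynomial (Fin n) K) (hbMatrix (K := K) S a₀) w) = 0 := by
  apply Subtype.ext
  rw [blockGenMap_apply_coe, Submodule.coe_zero]
  simp only [scalarMatrix_hbMatrix_eq_X_mul]
  exact (sum_mul_sq_erase_eq_zero_iff S _).2 ⟨hbCoeffR S a₀ w, fun a => rfl, sum_hbCoeffR ha₀ w⟩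

/-- `Φ` is injective on `R`-valued vectors. -/
theorem scalarMatrix_hbMatrix_injective :
    Function.Injective (scalarMatrix (MvPolynomial (Fin n) K) (hbMatrix (K := K) S a₀)) := by
  intro w w' h
  funext b
  have hb : (b : Fin n) ≠ a₀ := (Finset.mem_erase.1 b.2).1
  have := congr_fun h ⟨b.1, Finset.mem_of_mem_erase b.2⟩
  rw [scalarMatrix_hbMatrix_apply_of_ne S a₀ w _ hb, scalarMatrix_hbMatrix_apply_of_ne S a₀ w' _ hb] at this
  simp only [smul_eq_mul] at this
  exact X_mul_cancel_left_iff.1 this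

variable {S a₀} in
/-- Exactness at `R^S`: `E(v) = 0 ⟺ v = Φ(w)` (file XXVI's first syzygies). -/
theorem exact_scalarMatrix_hbMatrix_blockGenMap (ha₀ : a₀ ∈ S) :
    Function.Exact (scalarMatrix (MvPolynomial (Fin n) K) (hbMatrix (K := K) S a₀)) (blockGenMap S) := by
  intro v
  constructor
  · intro hv
    have h0 : ∑ a : ↥S, v a * sq (S.erase a.1) = 0 := by
      rw [← blockGenMap_apply_coe, hv, Submodule.coe_zero]
    obtain ⟨s, hs, hsum⟩ := (sum_mul_sq_erase_eq_zero_iff S _).1 h0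
    refine ⟨fun b => s ⟨b.1, Finset.mem_of_mem_erase b.2⟩, ?_⟩
    funext a
    by_cases h : (a : Fin n) = a₀
    · rw [scalarMatrix_hbMatrix_apply_of_eq S a₀ _ a h, hs a]
      have ha : a = ⟨a₀, ha₀⟩ := Subtype.ext h
      rw [sum_coe_eq_add_sum_erase ha₀] at hsum
      rw [ha, eq_neg_of_add_eq_zero_left hsum, smul_eq_mul]
      ring
    · rw [scalarMatrix_hbMatrix_apply_of_ne S a₀ _ a h, hs a, smul_eq_mul]
  · rintro ⟨w, rfl⟩
    exact blockGenMap_scalarMatrix_hbMatrix ha₀ w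

variable {a₀}

variable (K) in
/-- **`0 → R^{S∖a₀} →Φ R^S →E I_S → 0`** in `ModuleCat R`, with honest `R`-valued powers. -/
noncomputable abbrev hbSES (ha₀ : a₀ ∈ S) : ShortComplex (ModuleCat.{u} (MvPolynomial (Fin n) K)) :=
  ModuleCat.shortComplexOfCompEqZero (scalarMatrix (MvPolynomial (Fin n) K) (hbMatrix (K := K) S a₀))
    (blockGenMap S) (LinearMap.ext fun w => blockGenMap_scalarMatrix_hbMatrix ha₀ w)

/-- It is short exact. -/
theorem hbSES_shortExact (ha₀ : a₀ ∈ S) : (hbSES K S ha₀).ShortExact :=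
  ModuleCat.shortComplex_shortExact _ (exact_scalarMatrix_hbMatrix_blockGenMap ha₀)
    (scalarMatrix_hbMatrix_injective S a₀) (blockGenMap_surjective S)

/-- The first map of `hbSES` is `Φ`. -/
theorem hbSES_f (ha₀ : a₀ ∈ S) :
    (hbSES K S ha₀).f = ModuleCat.ofHom (scalarMatrix (MvPolynomial (Fin n) K) (hbMatrix (K := K) S a₀)) := rfl

end HB

/-! ## `Ext⁰` of a free module of finite rank, as a module of vectors, and the `k = 0` cokernel -/

section Core

variable (S : Finset (Fin n)) {a₀ : Fin n}

/-- `Ext⁰(R^T, N) ≃ₗ[R] N^T`: `Ext⁰ = Hom` (Mathlib's `Ext.linearEquiv₀`), `Hom` as linear maps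
(`ModuleCat.homLinearEquiv`), and `Hom_R(R^T, N) = N^T` (`LinearEquiv.piRing`). -/
noncomputable def extZeroPiEquiv (T : Finset (Fin n)) (N : Type u) [AddCommGroup N]
    [Module (MvPolynomial (Fin n) K) N] :
    Ext.{u} (ModuleCat.of (MvPolynomial (Fin n) K) (↥T → MvPolynomial (Fin n) K))
        (ModuleCat.of (MvPolynomial (Fin n) K) N) 0
      ≃ₗ[MvPolynomial (Fin n) K] (↥T → N) :=
  (Ext.linearEquiv₀ (R := MvPolynomial (Fin n) K)).trans
    ((ModuleCat.homLinearEquiv (S := MvPolynomial (Fin n) K)).trans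
      (LinearEquiv.piRing (MvPolynomial (Fin n) K) N ↥T (MvPolynomial (Fin n) K)))

/-- `Ext⁰ = Hom` on a class `[f]`. -/
theorem linearEquiv₀_mk₀ {X Y : ModuleCat.{u} (MvPolynomial (Fin n) K)} (f : X ⟶ Y) :
    Ext.linearEquiv₀ (R := MvPolynomial (Fin n) K) (Ext.mk₀ f) = f := by
  apply (Ext.linearEquiv₀ (R := MvPolynomial (Fin n) K)).symm.injective
  rw [LinearEquiv.symm_apply_apply, Ext.linearEquiv₀_symm_apply]

/-- Its value on `[φ]`: the vector `(φ(e_b))_b`. -/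
theorem extZeroPiEquiv_mk₀ (T : Finset (Fin n)) {N : Type u} [AddCommGroup N]
    [Module (MvPolynomial (Fin n) K) N]
    (φ : (↥T → MvPolynomial (Fin n) K) →ₗ[MvPolynomial (Fin n) K] N) (b : ↥T) :
    extZeroPiEquiv T N (Ext.mk₀ (ModuleCat.ofHom φ)) b = φ (Pi.single b 1) := by
  simp only [extZeroPiEquiv, LinearEquiv.trans_apply, linearEquiv₀_mk₀, LinearEquiv.piRing_apply]
  rfl

/-- **Naturality**: under `extZeroPiEquiv`, precomposition with `[Φ]` is the TRANSPOSE matrix `Φᵀ` on vectors. -/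
theorem extZeroPiEquiv_precomp (T₁ T₂ : Finset (Fin n)) (c : ↥T₂ → ↥T₁ → MvPolynomial (Fin n) K)
    {N : Type u} [AddCommGroup N] [Module (MvPolynomial (Fin n) K) N]
    (ζ : Ext.{u} (ModuleCat.of (MvPolynomial (Fin n) K) (↥T₂ → MvPolynomial (Fin n) K))
      (ModuleCat.of (MvPolynomial (Fin n) K) N) 0) :
    extZeroPiEquiv T₁ N ((Ext.mk₀ (ModuleCat.ofHom (scalarMatrix (MvPolynomial (Fin n) K) c))).comp ζ
        (zero_add 0)) =
      scalarMatrix N (fun b a => c a b) (extZeroPiEquiv T₂ N ζ) := by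
  obtain ⟨ψ, rfl⟩ := (Ext.mk₀_bijective _ _).2 ζ
  rw [Ext.mk₀_comp_mk₀]
  funext b
  have : ModuleCat.ofHom (scalarMatrix (MvPolynomial (Fin n) K) c) ≫ ψ =
      ModuleCat.ofHom (ψ.hom ∘ₗ scalarMatrix (MvPolynomial (Fin n) K) c) := rfl
  rw [this, extZeroPiEquiv_mk₀, scalarMatrix_apply]
  have hψ : ψ = ModuleCat.ofHom ψ.hom := rfl
  conv_rhs => rw [hψ]
  simp only [extZeroPiEquiv_mk₀, LinearMap.comp_apply]
  have key : scalarMatrix (MvPolynomial (Fin n) K) c (Pi.single b 1) =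
      ∑ a, c a b • (Pi.single a 1 : ↥T₂ → MvPolynomial (Fin n) K) := by
    funext a
    rw [scalarMatrix_apply, Finset.sum_apply, Finset.sum_eq_single b, Finset.sum_eq_single a]
    · simp
    · intro a' _ ha'; simp [Ne.symm ha']
    · intro h; exact absurd (Finset.mem_univ a) h
    · intro b' _ hb'; simp [Ne.symm hb']
    · intro h; exact absurd (Finset.mem_univ b) h
  rw [key, map_sum]
  refine Finset.sum_congr rfl fun a _ => ?_
  rw [map_smul]

/-- Under `extZeroPiEquiv`, the range of `f^* = [Φ]^*` on `Ext⁰` is the range of `Φᵀ` on `I_S`-valued vectors. -/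
theorem map_range_transpose_eq (ha₀ : a₀ ∈ S) :
    (LinearMap.range (scalarMatrix ↥(blockIdeal K S) (fun b a => hbMatrix (K := K) S a₀ a b))).map
        ((extZeroPiEquiv (K := K) (S.erase a₀) ↥(blockIdeal K S)).symm :
          (↥(S.erase a₀) → ↥(blockIdeal K S)) →ₗ[MvPolynomial (Fin n) K] _) =
      LinearMap.range (extPrecomp (S := hbSES K S ha₀)
        (ModuleCat.of (MvPolynomial (Fin n) K) ↥(blockIdeal K S)) 0) := by
  ext η
  simp only [Submodule.mem_map, LinearMap.mem_range, LinearEquiv.coe_coe]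
  constructor
  · rintro ⟨_, ⟨v, rfl⟩, rfl⟩
    refine ⟨(extZeroPiEquiv (K := K) S ↥(blockIdeal K S)).symm v, ?_⟩
    apply (extZeroPiEquiv (K := K) (S.erase a₀) ↥(blockIdeal K S)).injective
    rw [extPrecomp_apply, hbSES_f, extZeroPiEquiv_precomp, LinearEquiv.apply_symm_apply,
      LinearEquiv.apply_symm_apply]
  · rintro ⟨ζ, rfl⟩
    refine ⟨_, ⟨extZeroPiEquiv (K := K) S ↥(blockIdeal K S) ζ, rfl⟩, ?_⟩
    apply (extZeroPiEquiv (K := K) (S.erase a₀) ↥(blockIdeal K S)).injective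
    rw [LinearEquiv.apply_symm_apply, extPrecomp_apply, hbSES_f, extZeroPiEquiv_precomp]

/-- **The core**: `(I_S)^{S∖a₀} ⧸ range(Φᵀ on I_S-valued vectors) ≃ₗ[R] Ext¹_R(I_S, I_S)` — the `k = 0` cokernel
along `hbSES` (`R^S` is free, so `Ext¹(R^S, I_S) = 0`). -/
noncomputable def coreEquiv (ha₀ : a₀ ∈ S) :
    ((↥(S.erase a₀) → ↥(blockIdeal K S)) ⧸
        LinearMap.range (scalarMatrix ↥(blockIdeal K S) (fun b a => hbMatrix (K := K) S a₀ a b)))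
      ≃ₗ[MvPolynomial (Fin n) K]
        Ext.{u} (ModuleCat.of (MvPolynomial (Fin n) K) ↥(blockIdeal K S))
          (ModuleCat.of (MvPolynomial (Fin n) K) ↥(blockIdeal K S)) 1 :=
  (Submodule.Quotient.equiv _ _ (extZeroPiEquiv (K := K) (S.erase a₀) ↥(blockIdeal K S)).symm
      (map_range_transpose_eq S ha₀)).trans
    (extCokernelEquiv (hbSES_shortExact (K := K) S ha₀) (ModuleCat.of (MvPolynomial (Fin n) K) ↥(blockIdeal K S)) 0
      fun e => Ext.eq_zero_of_projective e)

variable (K) in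
/-- **`(I_S)^{S∖a₀} ⧸ range Φᵀ ≃ₗ[R] N_S = Π_{(a,b) ∈ Br(S)} R ⧸ (x_b, x_a)`** (∘ file XXVI's `extOneEquivOfUnique` for
the single-block structure `Blocks.single S`). -/
noncomputable def coreEquivBranch (hS : S.Nonempty) (ha₀ : a₀ ∈ S) :
    ((↥(S.erase a₀) → ↥(blockIdeal K S)) ⧸
        LinearMap.range (scalarMatrix ↥(blockIdeal K S) (fun b a => hbMatrix (K := K) S a₀ a b)))
      ≃ₗ[MvPolynomial (Fin n) K] BranchFunctions K (Blocks.single S hS) :=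
  (coreEquiv S ha₀).trans
    ((extCongrOfEq (arrIdeal_single (K := K) S hS).symm).trans (extOneEquivOfUnique K (Blocks.single S hS)))
where
  /-- Transport of `Ext¹(J, J)` along an equality of ideals. -/
  extCongrOfEq {J J' : Ideal (MvPolynomial (Fin n) K)} (h : J = J') :
      Ext.{u} (ModuleCat.of (MvPolynomial (Fin n) K) ↥J) (ModuleCat.of (MvPolynomial (Fin n) K) ↥J) 1
        ≃ₗ[MvPolynomial (Fin n) K]
          Ext.{u} (ModuleCat.of (MvPolynomial (Fin n) K) ↥J') (ModuleCat.of (MvPolynomial (Fin n) K) ↥J') 1 := by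
    subst h; exact LinearEquiv.refl _ _

end Core

end Summit.Ventures.HSemireg.ObstructionLocus.BlockModel
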